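import Mathlib
import HarnessLib
import Summits.Ventures.LatticeQCDFlow.Scoring.KishESSBlockStatistics
import Summits.Ventures.LatticeQCDFlow.Scoring.BlockMeanHeavyTail

/-!
# The ESS column with HEAVY-TAILED weights: the median of the printed block Kish fractions is
# within a factor `1 ± ρ` of `ESS = 1/M₂` with probability `≥ 1 − e^{−R/8}` as soon as the
# weight has a finite `(2 + 2ε)`-th moment under the model — no ceiling, no fourth moment

HONEST FRAMING: exact (Metropolis-corrected) sampling algorithms for lattice gauge theory;
figures of merit are autocorrelation/cost numbers at stated couplings and volumes; no
continuum-physics claim.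

Venture `LatticeQCDFlow` (cell pub-lqcd), topic `Scoring`; FANOUT row 4 (`s0-u1-b`, rung S0-B).
`Scoring/KishESSCeilingFree` certifies the ESS column from the printed per-block Kish fractions
`K_r = (Σ_j w̃_j)²/(m Σ_j w̃_j²)` under a FOURTH weight moment (`E_q w⁴ = ∫ p⁴/q³ dμ < ∞`, Chebyshev
for the block mean squared weight) and lists heavier tails as NOT CLAIMED.  Importance weights
are the textbook heavy-tailed case, so here the Chebyshev step for `F̄_r = Σ_j w_j²/m` is replaced
by the `(1 + ε)`-th-moment truncation bound of `Scoring/BlockMeanHeavyTail` applied to the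
non-negative score `w²`: the only tail input is `E_q (w²)^{1+ε} = ∫ p^{2+2ε}/q^{1+2ε} dμ = A_ε < ∞`
for some `0 < ε ≤ 1` (stated as `Integrable`), i.e. a `(2 + 2ε)`-th weight moment; the block mean
weight `W̄_r` keeps its Chebyshev step (`Var_q w = M₂ − 1`), the ratio step and the scale-freeness
are those of `Scoring/KishESSBlockStatistics`, and row 4's median device
(`BlockMedian.measureReal_half_far_le`) gives the exponential certificate.  NEW WORK of the cell
(elementary); no definition (`Scoring.kishESS` reused); nothing cited as a fact; the
median-of-means literature (Nemirovsky–Yudin 1983; Bubeck–Cesa-Bianchi–Lugosi 2013;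
Lugosi–Mendelson 2019) and the importance-sampling sample-size literature (Chatterjee–Diaconis
2018; Agapiou et al. 2017) are NAMED ONLY.

## Content (`ν = μ.withDensity q`; `w = p/q`; `M₂ = ∫ p²/q dμ`; `A_ε = ∫ p^{2+2ε}/q^{1+2ε} dμ`;
## `K_r = kishESS(block r)/m`; `ρ(u, s) = (u(2 + u) + s)/(1 − s)`)

* §1 `sqWeight_rpow_mul_model` (`((p/q)²)^{1+ε}·q = p^{2+2ε}/q^{1+2ε}`),
  `integrable_sqWeight_rpow_model`, `integral_sqWeight_rpow_model` (`E_ν (w²)^{1+ε} = A_ε`),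
  **`blockSqWeightMean_heavyTail_iid`** (`P(t ≤ |F̄ − M₂|) ≤ 5A_ε/(m^ε t^{1+ε})`).
* §2 for weights printed with ANY normalisation `w̃ = c·p/q`, `c > 0`, blocks of `m ≥ 1` draws,
  `R·m ≤ n`, `u > 0`, `0 < s < 1`, `8(M₂ − 1) ≤ m u²`, `40A_ε ≤ m^ε (sM₂)^{1+ε}`:
  **`kishESS_medianOfBlocks_confidence_heavyTail`**
  (`P(#{r < R : ρ ≤ |K_r·M₂ − 1|} ≥ R/2) ≤ e^{−R/8}`),
  **`kishESS_sampleMedian_confidence_heavyTail`** (ANY sample-median selection `med(ω)`: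
  `P(ρ ≤ |med·M₂ − 1|) ≤ e^{−R/8}`) and `kishESS_sampleMedian_confidence_heavyTail_abs`
  (`P(ρ ≤ |med − ESS|) ≤ e^{−R/8}`); two codes compare by adding the two bounds.

Reading (value-free): the ESS column of a flow whose weights have only `2 + 2ε` model moments is
still certified to a factor `1 ± ρ(u, s)` at confidence `1 − e^{−R/8}` from `R` printed block Kish
fractions, with `u² ≥ 8(1/ESS − 1)/m` and `s^{1+ε} ≥ 40·(A_ε/M₂^{1+ε})/m^ε`.  NOT CLAIMED:
estimating `A_ε` (an input); `ε = 0` (only `M₂ < ∞`: no rate); the chain-side column; optimal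
constants; any number of ours re-scored.
-/

noncomputable section

namespace Summit.Ventures.LatticeQCDFlow.Scoring.KishESSMedian

open MeasureTheory ProbabilityTheory Finset Real Set
open Summit.Ventures.LatticeQCDFlow.Scoring.BlockMedian
open Summit.Ventures.LatticeQCDFlow.Scoring.AllPairsMedian
open Summit.Ventures.LatticeQCDFlow.Scoring.ReweightingMedian
open Summit.Ventures.LatticeQCDFlow.Scoring.HeavyTailMedian

/-! ## §1 The squared weight at the `(1 + ε)`-th moment -/

section Model

variable {X : Type*} [MeasurableSpace X] {μ : Measure X} {p q : X → ℝ} {ε : ℝ}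

omit [MeasurableSpace X] in
/-- `((p/q)²)^{1+ε}·q = p^{2+2ε}/q^{1+2ε}` pointwise (`p ≥ 0`, `q > 0`). [ours] -/
theorem sqWeight_rpow_mul_model (hp0 : ∀ z, 0 ≤ p z) (hq0 : ∀ z, 0 < q z) (a : X) :
    ((p a / q a) ^ 2) ^ (1 + ε) * q a = p a ^ (2 + 2 * ε) / q a ^ (1 + 2 * ε) := by
  have hqa := hq0 a
  have hw0 : 0 ≤ p a / q a := div_nonneg (hp0 a) hqa.le
  have e1 : ((p a / q a) ^ 2) ^ (1 + ε) = (p a / q a) ^ (2 + 2 * ε) := by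
    rw [← Real.rpow_two, ← Real.rpow_mul hw0]
    congr 1
    ring
  have e2 : q a ^ (2 + 2 * ε) = q a ^ (1 + 2 * ε) * q a := by
    rw [show (2 : ℝ) + 2 * ε = (1 + 2 * ε) + 1 by ring, Real.rpow_add hqa, Real.rpow_one]
  rw [e1, Real.div_rpow (hp0 a) hqa.le, e2]
  have hq1 : 0 < q a ^ (1 + 2 * ε) := Real.rpow_pos_of_pos hqa _
  field_simp

/-- **`(w²)^{1+ε} ∈ L¹(q dμ)` from `p^{2+2ε}/q^{1+2ε} ∈ L¹(μ)`.** [ours] -/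
theorem integrable_sqWeight_rpow_model (hp0 : ∀ z, 0 ≤ p z) (hq0 : ∀ z, 0 < q z)
    (hqm : Measurable q)
    (hAi : Integrable (fun z => p z ^ (2 + 2 * ε) / q z ^ (1 + 2 * ε)) μ) :
    Integrable (fun a => ((p a / q a) ^ 2) ^ (1 + ε))
      (μ.withDensity fun z => ENNReal.ofReal (q z)) := by
  rw [AllPairsVariance.integrable_withDensity_iff' (fun z => (hq0 z).le) hqm]
  have h : (fun a => ((p a / q a) ^ 2) ^ (1 + ε) * q a)
      = fun a => p a ^ (2 + 2 * ε) / q a ^ (1 + 2 * ε) :=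
    funext fun a => sqWeight_rpow_mul_model hp0 hq0 a
  rw [h]
  exact hAi

/-- `E_ν (w²)^{1+ε} = ∫ p^{2+2ε}/q^{1+2ε} dμ = A_ε`. [ours] -/
theorem integral_sqWeight_rpow_model (hp0 : ∀ z, 0 ≤ p z) (hq0 : ∀ z, 0 < q z)
    (hqm : Measurable q) :
    ∫ a, ((p a / q a) ^ 2) ^ (1 + ε) ∂(μ.withDensity fun z => ENNReal.ofReal (q z))
      = ∫ z, p z ^ (2 + 2 * ε) / q z ^ (1 + 2 * ε) ∂μ := by
  rw [AllPairsVariance.integral_withDensity_eq' (fun z => (hq0 z).le) hqm]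
  exact integral_congr_ae (Filter.Eventually.of_forall fun a => sqWeight_rpow_mul_model hp0 hq0 a)

variable {Ω : Type*} [MeasurableSpace Ω] {P : Measure Ω} [IsProbabilityMeasure P] {m : ℕ}

/-- **THE MEAN SQUARED WEIGHT OF `m` INDEPENDENT MODEL DRAWS UNDER A `(2 + 2ε)`-TH WEIGHT MOMENT**:
`P(t ≤ |F̄ − M₂|) ≤ 5A_ε/(m^ε t^{1+ε})`, `F̄ = Σ_{j<m} w(x_j)²/m`, `0 < ε ≤ 1`, `t > 0`. [ours] -/
theorem blockSqWeightMean_heavyTail_iid {x : Fin m → Ω → X} (hxm : ∀ j, Measurable (x j))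
    (hind : iIndepFun x P) (hp0 : ∀ z, 0 ≤ p z) (hpm : Measurable p) (hq0 : ∀ z, 0 < q z)
    (hqm : Measurable q) (hε0 : 0 < ε) (hε1 : ε ≤ 1)
    (hAi : Integrable (fun z => p z ^ (2 + 2 * ε) / q z ^ (1 + 2 * ε)) μ)
    (hlaw : ∀ j, Measure.map (x j) P = μ.withDensity fun z => ENNReal.ofReal (q z))
    (hm : 1 ≤ m) {t : ℝ} (ht : 0 < t) :
    P.real {ω | t ≤ |(∑ j : Fin m, (p (x j ω) / q (x j ω)) ^ 2) / m - ∫ z, p z ^ 2 / q z ∂μ|}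
      ≤ 5 * (∫ z, p z ^ (2 + 2 * ε) / q z ^ (1 + 2 * ε) ∂μ) / ((m : ℝ) ^ ε * t ^ (1 + ε)) := by
  have h := blockMean_heavyTail_iid (ν := μ.withDensity fun z => ENNReal.ofReal (q z))
    hxm hind hlaw (g := fun a => (p a / q a) ^ 2) ((hpm.div hqm).pow_const 2)
    (fun a => sq_nonneg _) hε0 hε1 (integrable_sqWeight_rpow_model hp0 hq0 hqm hAi) hm ht
  rw [integral_sq_weight_model hq0 hqm, integral_sqWeight_rpow_model hp0 hq0 hqm] at h
  exact h

end Model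

/-! ## §2 The certificates -/

section Certificate

variable {Ω : Type*} [MeasurableSpace Ω] {P : Measure Ω} [IsProbabilityMeasure P]
variable {X : Type*} [MeasurableSpace X] {μ : Measure X} {p q : X → ℝ} {ε : ℝ} {n m R : ℕ}

/-- **THE ESS COLUMN WITH HEAVY-TAILED WEIGHTS, EXPONENTIAL CONFIDENCE (relative form).**  `n`
independent model draws `y_j` (laws `μ.withDensity q`); `p ≥ 0` measurable, integrable, `∫ p = 1`,
with `p²/q ∈ L¹(μ)` (`M₂ = 1/ESS`) and `p^{2+2ε}/q^{1+2ε} ∈ L¹(μ)` (`A_ε`) for some `0 < ε ≤ 1`;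
`q > 0` measurable; weights printed with ANY normalisation `w̃ = c·p/q`, `c > 0`; blocks of `m ≥ 1`
draws, `R·m ≤ n`; `u > 0`, `0 < s < 1` with `8(M₂ − 1) ≤ m u²` and `40A_ε ≤ m^ε (sM₂)^{1+ε}`.  With
`K_r` the printed Kish fraction of block `r`:
`P( #{r < R : (u(2 + u) + s)/(1 − s) ≤ |K_r·M₂ − 1|} ≥ R/2 ) ≤ exp(−R/8)`. [ours] -/
theorem kishESS_medianOfBlocks_confidence_heavyTail {y : Fin n → Ω → X}
    (hym : ∀ j, Measurable (y j)) (hind : iIndepFun y P) (hp0 : ∀ z, 0 ≤ p z)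
    (hpm : Measurable p) (hpi : Integrable p μ) (hp1 : ∫ z, p z ∂μ = 1) (hq0 : ∀ z, 0 < q z)
    (hqm : Measurable q) (hM2i : Integrable (fun z => p z ^ 2 / q z) μ) (hε0 : 0 < ε)
    (hε1 : ε ≤ 1) (hAi : Integrable (fun z => p z ^ (2 + 2 * ε) / q z ^ (1 + 2 * ε)) μ)
    (hlaw : ∀ j, Measure.map (y j) P = μ.withDensity fun z => ENNReal.ofReal (q z))
    {wt : X → ℝ} {c : ℝ} (hc : 0 < c) (hwt : ∀ z, wt z = c * (p z / q z))
    (hm : 1 ≤ m) (hRm : R * m ≤ n) {u s : ℝ} (hu : 0 < u) (hs : 0 < s) (hs1 : s < 1)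
    (hvu : 8 * ((∫ z, p z ^ 2 / q z ∂μ) - 1) ≤ m * u ^ 2)
    (hvs : 40 * ∫ z, p z ^ (2 + 2 * ε) / q z ^ (1 + 2 * ε) ∂μ
      ≤ (m : ℝ) ^ ε * (s * ∫ z, p z ^ 2 / q z ∂μ) ^ (1 + ε)) :
    P.real {ω | (R : ℝ) / 2 ≤ #{r ∈ (univ : Finset (Fin R)) | (u * (2 + u) + s) / (1 - s) ≤
        |kishESS (univ : Finset (Fin m))
              (fun j => wt (y ⟨((r : Fin R) : ℕ) * m + j, mul_add_lt hRm r j⟩ ω)) / m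
            * (∫ z, p z ^ 2 / q z ∂μ) - 1|}} ≤ exp (-(R / 8)) := by
  rcases Nat.eq_zero_or_pos R with hR | hR
  · subst hR
    refine measureReal_le_one.trans ?_
    simp
  have hn : 0 < n := by
    have : 0 < R * m := Nat.mul_pos hR (by omega)
    omega
  have hν : IsProbabilityMeasure (μ.withDensity fun z => ENNReal.ofReal (q z)) :=
    isProbabilityMeasure_of_map_eq_iid (hym ⟨0, hn⟩) (hlaw ⟨0, hn⟩)
  set M : ℝ := ∫ z, p z ^ 2 / q z ∂μ with hMdef
  set A : ℝ := ∫ z, p z ^ (2 + 2 * ε) / q z ^ (1 + 2 * ε) ∂μ with hAdef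
  have hM1 : 1 ≤ M := one_le_secondMoment_model hν hpm hpi hp1 hq0 hqm hM2i
  have hM0 : 0 < M := one_pos.trans_le hM1
  have hwtm : Measurable wt := by
    have : wt = fun z => c * (p z / q z) := funext hwt
    rw [this]
    exact (hpm.div hqm).const_mul c
  have hm0 : (0 : ℝ) < m := by exact_mod_cast hm
  have hD : 0 < (m : ℝ) ^ ε * (s * M) ^ (1 + ε) :=
    mul_pos (Real.rpow_pos_of_pos hm0 _) (Real.rpow_pos_of_pos (mul_pos hs hM0) _)
  -- the block statistic `K_r·M` as a measurable function of the block; independence across blocks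
  have hg : Measurable fun (v : Fin m → X) =>
      kishESS (univ : Finset (Fin m)) (fun j => wt (v j)) / m * M := by
    unfold kishESS
    exact ((((Finset.measurable_sum _ fun (j : Fin m) _ =>
        hwtm.comp (measurable_pi_apply j)).pow_const 2).div
      (Finset.measurable_sum _ fun (j : Fin m) _ =>
        (hwtm.comp (measurable_pi_apply j)).pow_const 2)).div_const _).mul_const _
  have hYind : iIndepFun (fun (r : Fin R) ω => kishESS (univ : Finset (Fin m))
      (fun j => wt (y ⟨(r : ℕ) * m + j, mul_add_lt hRm r j⟩ ω)) / m * M) P :=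
    iIndepFun_blockFun hym hind hRm hg
  have hYm : ∀ r : Fin R, Measurable fun ω => kishESS (univ : Finset (Fin m))
      (fun j => wt (y ⟨(r : ℕ) * m + j, mul_add_lt hRm r j⟩ ω)) / m * M := fun r => by
    have hblk : Measurable fun ω => fun (i : Fin m) => y ⟨(r : ℕ) * m + i, mul_add_lt hRm r i⟩ ω :=
      measurable_pi_lambda _ fun i => hym _
    exact hg.comp hblk
  -- each block is bad with probability ≤ 1/8 + 1/8
  have hfar : ∀ r ∈ (univ : Finset (Fin R)), P.real {ω | (u * (2 + u) + s) / (1 - s) ≤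
      |kishESS (univ : Finset (Fin m))
          (fun j => wt (y ⟨(r : ℕ) * m + j, mul_add_lt hRm r j⟩ ω)) / m * M - 1|} ≤ 1 / 4 := by
    intro r _
    have hW := meanWeight_chebyshev_iid
      (x := fun (i : Fin m) => y ⟨(r : ℕ) * m + i, mul_add_lt hRm r i⟩) (fun i => hym _)
      (iIndepFun_block hind hRm r) hpm hpi hp1 hq0 hqm hM2i (fun i => hlaw _) hm hu
    have hF := blockSqWeightMean_heavyTail_iid
      (x := fun (i : Fin m) => y ⟨(r : ℕ) * m + i, mul_add_lt hRm r i⟩) (fun i => hym _)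
      (iIndepFun_block hind hRm r) hp0 hpm hq0 hqm hε0 hε1 hAi (fun i => hlaw _) hm
      (t := s * M) (mul_pos hs hM0)
    have hratio : ∀ ω, kishESS (univ : Finset (Fin m))
          (fun j => wt (y ⟨(r : ℕ) * m + j, mul_add_lt hRm r j⟩ ω)) / m
        = ((∑ j : Fin m, p (y ⟨(r : ℕ) * m + j, mul_add_lt hRm r j⟩ ω)
              / q (y ⟨(r : ℕ) * m + j, mul_add_lt hRm r j⟩ ω)) / m) ^ 2
          / ((∑ j : Fin m, (p (y ⟨(r : ℕ) * m + j, mul_add_lt hRm r j⟩ ω)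
              / q (y ⟨(r : ℕ) * m + j, mul_add_lt hRm r j⟩ ω)) ^ 2) / m) := fun ω => by
      rw [blockKish_scale_free hc.ne' hwt fun i => y ⟨(r : ℕ) * m + i, mul_add_lt hRm r i⟩ ω,
        kishFrac_eq_sq_div]
    have hsub : {ω | (u * (2 + u) + s) / (1 - s) ≤
          |kishESS (univ : Finset (Fin m))
              (fun j => wt (y ⟨(r : ℕ) * m + j, mul_add_lt hRm r j⟩ ω)) / m * M - 1|}
        ⊆ {ω | u ≤ |(∑ j : Fin m, p (y ⟨(r : ℕ) * m + j, mul_add_lt hRm r j⟩ ω)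
              / q (y ⟨(r : ℕ) * m + j, mul_add_lt hRm r j⟩ ω)) / m - 1|}
          ∪ {ω | s * M ≤ |(∑ j : Fin m, (p (y ⟨(r : ℕ) * m + j, mul_add_lt hRm r j⟩ ω)
              / q (y ⟨(r : ℕ) * m + j, mul_add_lt hRm r j⟩ ω)) ^ 2) / m - M|} := by
      intro ω hω
      simp only [Set.mem_setOf_eq, Set.mem_union] at hω ⊢
      rw [hratio ω] at hω
      by_contra hcon
      simp only [not_or, not_le] at hcon
      obtain ⟨h1, h2⟩ := hcon
      have key := abs_sq_div_mul_sub_one_lt hM0 hu.le hs1 h1 h2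
      linarith
    have hW' : ((∫ z, p z ^ 2 / q z ∂μ) - 1) / (m * u ^ 2) ≤ 1 / 8 := by
      rw [div_le_iff₀ (by positivity)]
      linarith
    have hF' : 5 * A / ((m : ℝ) ^ ε * (s * M) ^ (1 + ε)) ≤ 1 / 8 := by
      rw [div_le_iff₀ hD]
      linarith
    calc P.real _ ≤ P.real _ := measureReal_mono hsub
      _ ≤ _ := measureReal_union_le _ _
      _ ≤ 1 / 8 + 1 / 8 := add_le_add (hW.trans hW') (hF.trans hF')
      _ = 1 / 4 := by norm_num
  have h := measureReal_half_far_le (μ := P) (univ : Finset (Fin R)) hYind hYm 1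
    ((u * (2 + u) + s) / (1 - s)) hfar
  simpa only [card_univ, Fintype.card_fin] using h

/-- **THE ESS COLUMN WITH HEAVY-TAILED WEIGHTS, FOR ANY SAMPLE MEDIAN** `med(ω)` of the `R` printed
block Kish fractions: under the hypotheses of `kishESS_medianOfBlocks_confidence_heavyTail`,
`P( (u(2 + u) + s)/(1 − s) ≤ |med·M₂ − 1| ) ≤ exp(−R/8)`. [ours] -/
theorem kishESS_sampleMedian_confidence_heavyTail {y : Fin n → Ω → X}
    (hym : ∀ j, Measurable (y j)) (hind : iIndepFun y P) (hp0 : ∀ z, 0 ≤ p z)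
    (hpm : Measurable p) (hpi : Integrable p μ) (hp1 : ∫ z, p z ∂μ = 1) (hq0 : ∀ z, 0 < q z)
    (hqm : Measurable q) (hM2i : Integrable (fun z => p z ^ 2 / q z) μ) (hε0 : 0 < ε)
    (hε1 : ε ≤ 1) (hAi : Integrable (fun z => p z ^ (2 + 2 * ε) / q z ^ (1 + 2 * ε)) μ)
    (hlaw : ∀ j, Measure.map (y j) P = μ.withDensity fun z => ENNReal.ofReal (q z))
    {wt : X → ℝ} {c : ℝ} (hc : 0 < c) (hwt : ∀ z, wt z = c * (p z / q z))
    (hm : 1 ≤ m) (hRm : R * m ≤ n) {u s : ℝ} (hu : 0 < u) (hs : 0 < s) (hs1 : s < 1)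
    (hvu : 8 * ((∫ z, p z ^ 2 / q z ∂μ) - 1) ≤ m * u ^ 2)
    (hvs : 40 * ∫ z, p z ^ (2 + 2 * ε) / q z ^ (1 + 2 * ε) ∂μ
      ≤ (m : ℝ) ^ ε * (s * ∫ z, p z ^ 2 / q z ∂μ) ^ (1 + ε)) {med : Ω → ℝ}
    (hlo : ∀ ω, (R : ℝ) / 2 ≤ #{r ∈ (univ : Finset (Fin R)) | med ω ≤
        kishESS (univ : Finset (Fin m))
          (fun j => wt (y ⟨((r : Fin R) : ℕ) * m + j, mul_add_lt hRm r j⟩ ω)) / m})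
    (hhi : ∀ ω, (R : ℝ) / 2 ≤ #{r ∈ (univ : Finset (Fin R)) |
        kishESS (univ : Finset (Fin m))
          (fun j => wt (y ⟨((r : Fin R) : ℕ) * m + j, mul_add_lt hRm r j⟩ ω)) / m ≤ med ω}) :
    P.real {ω | (u * (2 + u) + s) / (1 - s) ≤ |med ω * (∫ z, p z ^ 2 / q z ∂μ) - 1|}
      ≤ exp (-(R / 8)) := by
  rcases Nat.eq_zero_or_pos R with hR | hR
  · subst hR
    refine measureReal_le_one.trans ?_
    simp
  have hn : 0 < n := by
    have : 0 < R * m := Nat.mul_pos hR (by omega)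
    omega
  have hν : IsProbabilityMeasure (μ.withDensity fun z => ENNReal.ofReal (q z)) :=
    isProbabilityMeasure_of_map_eq_iid (hym ⟨0, hn⟩) (hlaw ⟨0, hn⟩)
  have hM0 : 0 < ∫ z, p z ^ 2 / q z ∂μ :=
    one_pos.trans_le (one_le_secondMoment_model hν hpm hpi hp1 hq0 hqm hM2i)
  refine (measureReal_mono ?_).trans
    (kishESS_medianOfBlocks_confidence_heavyTail hym hind hp0 hpm hpi hp1 hq0 hqm hM2i hε0 hε1
      hAi hlaw hc hwt hm hRm hu hs hs1 hvu hvs)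
  intro ω hω
  simp only [Set.mem_setOf_eq] at hω ⊢
  by_contra hlt
  push Not at hlt
  have hR' : (#(univ : Finset (Fin R)) : ℝ) = R := by rw [card_univ, Fintype.card_fin]
  have hlo' : (#(univ : Finset (Fin R)) : ℝ) / 2 ≤ #{r ∈ (univ : Finset (Fin R)) |
      med ω * (∫ z, p z ^ 2 / q z ∂μ) ≤ kishESS (univ : Finset (Fin m))
        (fun j => wt (y ⟨((r : Fin R) : ℕ) * m + j, mul_add_lt hRm r j⟩ ω)) / m
          * (∫ z, p z ^ 2 / q z ∂μ)} := by
    rw [hR']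
    refine (hlo ω).trans (le_of_eq ?_)
    congr 2
    ext r
    simp only [Finset.mem_filter, Finset.mem_univ, true_and]
    exact (mul_le_mul_iff_of_pos_right hM0).symm
  have hhi' : (#(univ : Finset (Fin R)) : ℝ) / 2 ≤ #{r ∈ (univ : Finset (Fin R)) |
      kishESS (univ : Finset (Fin m))
        (fun j => wt (y ⟨((r : Fin R) : ℕ) * m + j, mul_add_lt hRm r j⟩ ω)) / m
          * (∫ z, p z ^ 2 / q z ∂μ) ≤ med ω * (∫ z, p z ^ 2 / q z ∂μ)} := by
    rw [hR']
    refine (hhi ω).trans (le_of_eq ?_)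
    congr 2
    ext r
    simp only [Finset.mem_filter, Finset.mem_univ, true_and]
    exact (mul_le_mul_iff_of_pos_right hM0).symm
  have h := abs_median_sub_lt_of_card_lt (univ : Finset (Fin R)) _ hlo' hhi' (hR' ▸ hlt)
  linarith

/-- **THE ESS COLUMN WITH HEAVY-TAILED WEIGHTS, absolute form**: for any sample median `med(ω)`
of the printed block Kish fractions, `P( (u(2 + u) + s)/(1 − s) ≤ |med − ESS| ) ≤ exp(−R/8)`,
`ESS = (∫ p²/q dμ)⁻¹ ≤ 1`. [ours] -/
theorem kishESS_sampleMedian_confidence_heavyTail_abs {y : Fin n → Ω → X}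
    (hym : ∀ j, Measurable (y j)) (hind : iIndepFun y P) (hp0 : ∀ z, 0 ≤ p z)
    (hpm : Measurable p) (hpi : Integrable p μ) (hp1 : ∫ z, p z ∂μ = 1) (hq0 : ∀ z, 0 < q z)
    (hqm : Measurable q) (hM2i : Integrable (fun z => p z ^ 2 / q z) μ) (hε0 : 0 < ε)
    (hε1 : ε ≤ 1) (hAi : Integrable (fun z => p z ^ (2 + 2 * ε) / q z ^ (1 + 2 * ε)) μ)
    (hlaw : ∀ j, Measure.map (y j) P = μ.withDensity fun z => ENNReal.ofReal (q z))
    {wt : X → ℝ} {c : ℝ} (hc : 0 < c) (hwt : ∀ z, wt z = c * (p z / q z))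
    (hm : 1 ≤ m) (hRm : R * m ≤ n) {u s : ℝ} (hu : 0 < u) (hs : 0 < s) (hs1 : s < 1)
    (hvu : 8 * ((∫ z, p z ^ 2 / q z ∂μ) - 1) ≤ m * u ^ 2)
    (hvs : 40 * ∫ z, p z ^ (2 + 2 * ε) / q z ^ (1 + 2 * ε) ∂μ
      ≤ (m : ℝ) ^ ε * (s * ∫ z, p z ^ 2 / q z ∂μ) ^ (1 + ε)) {med : Ω → ℝ}
    (hlo : ∀ ω, (R : ℝ) / 2 ≤ #{r ∈ (univ : Finset (Fin R)) | med ω ≤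
        kishESS (univ : Finset (Fin m))
          (fun j => wt (y ⟨((r : Fin R) : ℕ) * m + j, mul_add_lt hRm r j⟩ ω)) / m})
    (hhi : ∀ ω, (R : ℝ) / 2 ≤ #{r ∈ (univ : Finset (Fin R)) |
        kishESS (univ : Finset (Fin m))
          (fun j => wt (y ⟨((r : Fin R) : ℕ) * m + j, mul_add_lt hRm r j⟩ ω)) / m ≤ med ω}) :
    P.real {ω | (u * (2 + u) + s) / (1 - s) ≤ |med ω - (∫ z, p z ^ 2 / q z ∂μ)⁻¹|}
      ≤ exp (-(R / 8)) := by
  rcases Nat.eq_zero_or_pos R with hR | hR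
  · subst hR
    refine measureReal_le_one.trans ?_
    simp
  have hn : 0 < n := by
    have : 0 < R * m := Nat.mul_pos hR (by omega)
    omega
  have hν : IsProbabilityMeasure (μ.withDensity fun z => ENNReal.ofReal (q z)) :=
    isProbabilityMeasure_of_map_eq_iid (hym ⟨0, hn⟩) (hlaw ⟨0, hn⟩)
  have hM1 : 1 ≤ ∫ z, p z ^ 2 / q z ∂μ := one_le_secondMoment_model hν hpm hpi hp1 hq0 hqm hM2i
  refine (measureReal_mono ?_).trans
    (kishESS_sampleMedian_confidence_heavyTail hym hind hp0 hpm hpi hp1 hq0 hqm hM2i hε0 hε1 hAi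
      hlaw hc hwt hm hRm hu hs hs1 hvu hvs hlo hhi)
  intro ω hω
  simp only [Set.mem_setOf_eq] at hω ⊢
  exact hω.trans (abs_sub_inv_le_of_one_le hM1)

end Certificate

end Summit.Ventures.LatticeQCDFlow.Scoring.KishESSMedian

end
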